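import Summits.HodgeConjecture.HodgeConjecture.Theorems.PadicSemiregularLiftFermatAnchorAssemblyStubRigidLiftAux
import Mathlib.RingTheory.WittVector.Complete

/-!
# `stub_rigidLift` (line `witt-lift-rigid-mf`, crux `FermatAnchorAssembly`) · auxiliaries II: the
`p`-adic lifting step over the Witt vectors

Registered helper sub-goal `liftStep` (H2) of the stub `stub_rigidLift` of crux
stmt-HodgeConjecture-14874, over the vocabulary of
`Theorems/PadicSemiregularLiftFermatAnchorAssemblyGMFDefs.lean`.

Conventions. For matrices `X, Y` of polynomials over `𝕎 𝕜` we phrase "`X ≡ Y (mod pᴺ)`" as the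
EQUALITY `X.map (MvPolynomial.map (WittVector.truncate N)) = Y.map (MvPolynomial.map (WittVector.truncate N))`
(equivalently: all Witt coefficients of index `< N` of all coefficients of all entries agree,
`map_truncate_eq_iff`), and "`X ≡ Y (mod p)`" through `WittVector.constantCoeff : 𝕎 𝕜 →+* 𝕜`.

* coefficientwise constructions (`exists_matrix_coeffwise`): Teichmüller LIFTS of matrices over `𝕜[x]`
  with the same monomial supports (`exists_lift_matrix`) and exact DIVISION by a common divisor of all
  coefficients keeping supports (`exists_eq_smul_of_dvd_coeff`);
* `𝕎 𝕜` bookkeeping for a perfect ring `𝕜`: `truncate N (p ^ j) = 0` for `N ≤ j`; congruence mod `pᴺ`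
  of all coefficients is divisibility by `pᴺ` (`WittVector.mem_span_p_pow_iff_le_coeff_eq_zero`);
  `pᴺ`-torsion-freeness (`WittVector.eq_zero_of_p_mul_eq_zero`);
* `liftStep`: given `(Φ, Ψ)` over `𝕎 𝕜` bihomogeneous of the bidegrees of `(φ, ψ)`, reducing to the
  rigid lawful `M = (φ, ψ)` and with `ΦΨ ≡ f·1`, `ΨΦ ≡ f·1 (mod pⁿ⁺¹)` (`f = Σ xᵢᵐ`), there is
  `(Φ', Ψ') ≡ (Φ, Ψ) (mod pⁿ⁺¹)` with the same properties modulo `pⁿ⁺²`. PROOF: write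
  `ΦΨ − f·1 = pⁿ⁺¹A`, `ΨΦ − f·1 = pⁿ⁺¹B`; from `Φ(ΨΦ) = (ΦΨ)Φ` and torsion-freeness `AΦ = ΦB`,
  `ΨA = BΨ`, so `(A, B) mod p` is a CLOSED even cochain of twist `m` of `M`, hence (rigidity,
  `closedSet_subset_nullSet_of_isRigid`) null-homotopic: `A ≡ uψ + φs`, `B ≡ sφ + ψu (mod p)`; with
  Teichmüller lifts `U, S` put `Φ' = Φ − pⁿ⁺¹U`, `Ψ' = Ψ − pⁿ⁺¹S`; then
  `Φ'Ψ' − f·1 = pⁿ⁺²C + p²ⁿ⁺²US` and symmetrically.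
-/

-- `Summit.HodgeConjecture.HodgeConjecture.…` is the tree's mandated summit/problem namespace (single-problem summit).
set_option linter.dupNamespace false

noncomputable section

open Finset

namespace Summit.HodgeConjecture.HodgeConjecture.Cruxes.FermatAnchorAssembly.WittLiftRigidMf

namespace RigidLift

/-! ### Coefficientwise constructions: lifts and exact division -/

section Coeffwise

variable {R S σ κ ι : Type} [CommSemiring R] [CommSemiring S]

/-- Apply a zero-preserving function to every coefficient of a polynomial (support can only shrink). [folklore] -/
theorem exists_coeffwise (f : R → S) (hf : f 0 = 0) (q : MvPolynomial σ R) :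
    ∃ q' : MvPolynomial σ S, (∀ e, q'.coeff e = f (q.coeff e)) ∧ q'.support ⊆ q.support :=
  ⟨AddMonoidAlgebra.ofCoeff (Finsupp.mapRange f hf (AddMonoidAlgebra.coeff q)),
    fun _ ↦ Finsupp.mapRange_apply (hf := hf), Finsupp.support_mapRange (hf := hf)⟩

/-- Apply a zero-preserving function to every coefficient of every entry of a matrix of polynomials. [folklore] -/
theorem exists_matrix_coeffwise (f : R → S) (hf : f 0 = 0) (X : Matrix κ ι (MvPolynomial σ R)) :
    ∃ X' : Matrix κ ι (MvPolynomial σ S),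
      (∀ k i e, (X' k i).coeff e = f ((X k i).coeff e)) ∧ ∀ k i, (X' k i).support ⊆ (X k i).support := by
  choose g hg hg' using fun k i ↦ exists_coeffwise f hf (X k i)
  exact ⟨Matrix.of g, fun k i e ↦ hg k i e, fun k i ↦ hg' k i⟩

/-- EXACT DIVISION keeping supports: if `r` divides every coefficient of every entry of `X` then
`X = r • Z` with `supp Z ⊆ supp X` entrywise. [folklore] -/
theorem exists_eq_smul_of_dvd_coeff (r : R) (X : Matrix κ ι (MvPolynomial σ R))
    (h : ∀ k i e, r ∣ (X k i).coeff e) :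
    ∃ Z : Matrix κ ι (MvPolynomial σ R), X = r • Z ∧ ∀ k i, (Z k i).support ⊆ (X k i).support := by
  classical
  let f : R → R := fun x ↦ if x = 0 then 0 else if hd : r ∣ x then Classical.choose hd else 0
  have hf0 : f 0 = 0 := by simp [f]
  have hf : ∀ x, r ∣ x → r * f x = x := by
    intro x hd
    by_cases hx : x = 0
    · simp [f, hx]
    · simp only [f, if_neg hx, dif_pos hd]
      exact (Classical.choose_spec hd).symm
  obtain ⟨Z, hZ, hZ'⟩ := exists_matrix_coeffwise f hf0 X
  refine ⟨Z, ?_, hZ'⟩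
  ext k i e
  rw [Matrix.smul_apply, MvPolynomial.coeff_smul, hZ, smul_eq_mul, hf _ (h k i e)]

/-- `(r • U) ↦ g r • g U` under an entrywise change of coefficients. [folklore] -/
theorem map_smul_matrix (g : R →+* S) (r : R) (U : Matrix κ ι (MvPolynomial σ R)) :
    (r • U).map (MvPolynomial.map g) = g r • U.map (MvPolynomial.map g) := by
  ext k i e
  simp [Matrix.map_apply, MvPolynomial.coeff_map, MvPolynomial.coeff_smul]

end Coeffwise

/-! ### Witt-vector bookkeeping -/

section Witt

variable {p : ℕ} [Fact p.Prime] {k σ κ ι : Type} [CommRing k]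

variable (p k) in
/-- TEICHMÜLLER LIFT of a matrix of polynomials over `k` to `𝕎 k`, entrywise with the same supports. [folklore] -/
theorem exists_lift_matrix (X : Matrix κ ι (MvPolynomial σ k)) :
    ∃ X' : Matrix κ ι (MvPolynomial σ (WittVector p k)),
      X'.map (MvPolynomial.map WittVector.constantCoeff) = X ∧
        ∀ a i, (X' a i).support ⊆ (X a i).support := by
  obtain ⟨X', h1, h2⟩ :=
    exists_matrix_coeffwise (WittVector.teichmuller p) (WittVector.teichmuller_zero p) X
  refine ⟨X', ?_, h2⟩
  ext a i e
  rw [Matrix.map_apply, MvPolynomial.coeff_map, h1, WittVector.constantCoeff_apply,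
    WittVector.teichmuller_coeff_zero]

/-- Reduction modulo `p` of matrices of polynomials, coefficientwise. [folklore] -/
theorem map_constantCoeff_eq_iff (X Y : Matrix κ ι (MvPolynomial σ (WittVector p k))) :
    X.map (MvPolynomial.map WittVector.constantCoeff) = Y.map (MvPolynomial.map WittVector.constantCoeff) ↔
      ∀ a i e, ((X a i).coeff e).coeff 0 = ((Y a i).coeff e).coeff 0 := by
  simp only [← Matrix.ext_iff, Matrix.map_apply, MvPolynomial.ext_iff, MvPolynomial.coeff_map,
    WittVector.constantCoeff_apply]

/-- Congruence modulo `pᴺ` of matrices of polynomials, coefficientwise. [folklore] -/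
theorem map_truncate_eq_iff (N : ℕ) (X Y : Matrix κ ι (MvPolynomial σ (WittVector p k))) :
    X.map (MvPolynomial.map (WittVector.truncate N)) = Y.map (MvPolynomial.map (WittVector.truncate N)) ↔
      ∀ a i e s, s < N → ((X a i).coeff e).coeff s = ((Y a i).coeff e).coeff s := by
  simp only [← Matrix.ext_iff, Matrix.map_apply, MvPolynomial.ext_iff, MvPolynomial.coeff_map]
  refine forall_congr' fun a ↦ forall_congr' fun i ↦ forall_congr' fun e ↦ ⟨fun h s hs ↦ ?_, fun h ↦ ?_⟩
  · have := congrArg (TruncatedWittVector.coeff ⟨s, hs⟩) h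
    simpa only [WittVector.coeff_truncate] using this
  · ext ⟨s, hs⟩
    simpa only [WittVector.coeff_truncate] using h s hs

/-- Congruence mod `p` is congruence mod `p¹`. [folklore] -/
theorem map_truncate_one_eq_of_map_constantCoeff_eq {X Y : Matrix κ ι (MvPolynomial σ (WittVector p k))}
    (h : X.map (MvPolynomial.map WittVector.constantCoeff) =
      Y.map (MvPolynomial.map WittVector.constantCoeff)) :
    X.map (MvPolynomial.map (WittVector.truncate 1)) = Y.map (MvPolynomial.map (WittVector.truncate 1)) := by
  rw [map_truncate_eq_iff]
  intro a i e s hs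
  obtain rfl : s = 0 := Nat.lt_one_iff.mp hs
  exact (map_constantCoeff_eq_iff X Y).mp h a i e

variable [CharP k p]

variable (k) in
/-- `pʲ ≡ 0 (mod pᴺ)` in `𝕎 k` for `N ≤ j` (`char k = p`). [folklore] -/
theorem truncate_p_pow_eq_zero {N j : ℕ} (h : N ≤ j) :
    WittVector.truncate N ((p : WittVector p k) ^ j) = 0 := by
  have := (WittVector.mem_ker_truncate N ((p : WittVector p k) ^ j)).mpr
    fun i hi ↦ WittVector.coeff_p_pow_eq_zero p k (Nat.ne_of_lt (lt_of_lt_of_le hi h))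
  rwa [RingHom.mem_ker] at this

/-- `pʲ • Z ≡ 0 (mod pᴺ)` for `N ≤ j`. [folklore] -/
theorem map_truncate_p_pow_smul {N j : ℕ} (h : N ≤ j) (Z : Matrix κ ι (MvPolynomial σ (WittVector p k))) :
    (((p : WittVector p k) ^ j) • Z).map (MvPolynomial.map (WittVector.truncate N)) = 0 := by
  rw [map_smul_matrix, truncate_p_pow_eq_zero k h, zero_smul]

/-- `Y − pʲ • Z ≡ Y (mod pᴺ)` for `N ≤ j`. [folklore] -/
theorem map_truncate_sub_p_pow_smul {N j : ℕ} (h : N ≤ j)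
    (Y Z : Matrix κ ι (MvPolynomial σ (WittVector p k))) :
    (Y - ((p : WittVector p k) ^ j) • Z).map (MvPolynomial.map (WittVector.truncate N)) =
      Y.map (MvPolynomial.map (WittVector.truncate N)) := by
  rw [Matrix.map_sub _ (map_sub _), map_truncate_p_pow_smul h, sub_zero]

/-- `Y + pʲ • Z + pʲ' • Z' ≡ Y (mod pᴺ)` for `N ≤ j, j'`. [folklore] -/
theorem map_truncate_add_add {N j j' : ℕ} (h : N ≤ j) (h' : N ≤ j')
    (Y Z Z' : Matrix κ ι (MvPolynomial σ (WittVector p k))) :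
    (Y + ((p : WittVector p k) ^ j) • Z + ((p : WittVector p k) ^ j') • Z').map
        (MvPolynomial.map (WittVector.truncate N)) =
      Y.map (MvPolynomial.map (WittVector.truncate N)) := by
  rw [Matrix.map_add _ (map_add _), Matrix.map_add _ (map_add _), map_truncate_p_pow_smul h,
    map_truncate_p_pow_smul h', add_zero, add_zero]

/-- `p` kills `k`: `pʲ • U ≡ 0 (mod p)` for `0 < j`. [folklore] -/
theorem map_constantCoeff_sub_p_pow_smul {j : ℕ} (hj : j ≠ 0)
    (Y Z : Matrix κ ι (MvPolynomial σ (WittVector p k))) :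
    (Y - ((p : WittVector p k) ^ j) • Z).map (MvPolynomial.map WittVector.constantCoeff) =
      Y.map (MvPolynomial.map WittVector.constantCoeff) := by
  rw [Matrix.map_sub _ (map_sub _), map_smul_matrix, map_pow, map_natCast, CharP.cast_eq_zero,
    zero_pow hj, zero_smul, sub_zero]

variable [PerfectRing k p]

/-- Over a perfect ring, congruence mod `p` of all coefficients is divisibility by `p`. [folklore] -/
theorem dvd_coeff_of_map_constantCoeff_eq {X Y : Matrix κ ι (MvPolynomial σ (WittVector p k))}
    (h : X.map (MvPolynomial.map WittVector.constantCoeff) =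
      Y.map (MvPolynomial.map WittVector.constantCoeff)) (a : κ) (i : ι) (e : σ →₀ ℕ) :
    (p : WittVector p k) ∣ ((X - Y) a i).coeff e := by
  rw [← Ideal.mem_span_singleton, WittVector.mem_span_p_iff_coeff_zero_eq_zero, Matrix.sub_apply,
    MvPolynomial.coeff_sub, ← WittVector.constantCoeff_apply, map_sub, sub_eq_zero,
    WittVector.constantCoeff_apply, WittVector.constantCoeff_apply]
  exact (map_constantCoeff_eq_iff X Y).mp h a i e

/-- Over a perfect ring, congruence mod `pᴺ` of all coefficients is divisibility by `pᴺ`. [folklore] -/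
theorem dvd_coeff_of_map_truncate_eq (N : ℕ) {X Y : Matrix κ ι (MvPolynomial σ (WittVector p k))}
    (h : X.map (MvPolynomial.map (WittVector.truncate N)) =
      Y.map (MvPolynomial.map (WittVector.truncate N))) (a : κ) (i : ι) (e : σ →₀ ℕ) :
    (p : WittVector p k) ^ N ∣ ((X - Y) a i).coeff e := by
  rw [← Ideal.mem_span_singleton, WittVector.mem_span_p_pow_iff_le_coeff_eq_zero, Matrix.sub_apply,
    MvPolynomial.coeff_sub, ← WittVector.le_coeff_eq_iff_le_sub_coeff_eq_zero]
  exact (map_truncate_eq_iff N X Y).mp h a i e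

/-- `𝕎 k` is `pᴺ`-torsion free for a perfect ring `k`. [folklore] -/
theorem eq_zero_of_p_pow_mul_eq_zero (N : ℕ) (x : WittVector p k) (h : (p : WittVector p k) ^ N * x = 0) :
    x = 0 := by
  induction N with
  | zero => simpa using h
  | succ N ih =>
    refine ih (WittVector.eq_zero_of_p_mul_eq_zero _ ?_)
    rw [← h, pow_succ]
    ring

/-- Cancelling `pᴺ` on matrices of polynomials over `𝕎 k`. [folklore] -/
theorem p_pow_smul_cancel (N : ℕ) {X Y : Matrix κ ι (MvPolynomial σ (WittVector p k))}
    (h : ((p : WittVector p k) ^ N) • X = ((p : WittVector p k) ^ N) • Y) : X = Y := by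
  refine Matrix.ext fun a i ↦ MvPolynomial.ext _ _ fun e ↦ ?_
  have h' := congrArg (fun Z : Matrix κ ι (MvPolynomial σ (WittVector p k)) ↦ (Z a i).coeff e) h
  simp only [Matrix.smul_apply, MvPolynomial.coeff_smul, smul_eq_mul] at h'
  rw [← sub_eq_zero] at h' ⊢
  have h'' : (p : WittVector p k) ^ N * ((X a i).coeff e - (Y a i).coeff e) = 0 := by
    rw [mul_sub]; exact h'
  exact eq_zero_of_p_pow_mul_eq_zero N _ h''

end Witt

end RigidLift

/-! ### The lifting step -/

open RigidLift in
/-- **Registered helper sub-goal (H2) of `stub_rigidLift`: one step of the `p`-adic lifting of a RIGID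
`L`-graded matrix factorization of the Fermat form.** `𝕜` perfect of characteristic `p`, `M = (φ, ψ)`
lawful and rigid over `𝕜`; if `(Φ, Ψ)` over `𝕎 𝕜` are bihomogeneous of the bidegrees of `(φ, ψ)`,
reduce to `(φ, ψ)` and satisfy `ΦΨ ≡ f·1`, `ΨΦ ≡ f·1 (mod pⁿ⁺¹)`, then some `(Φ', Ψ') ≡ (Φ, Ψ)
(mod pⁿ⁺¹)` has the same properties with `n + 2` in place of `n + 1`. [folklore] -/
theorem liftStep : ∀ (p : ℕ) [Fact p.Prime] (𝕜 : Type) [Field 𝕜] [CharP 𝕜 p] [PerfectRing 𝕜 p]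
    (ν m : ℕ) (ι₀ ι₁ : Type) [Fintype ι₀] [Fintype ι₁] [DecidableEq ι₀] [DecidableEq ι₁]
    (L : AddSubgroup (Fin ν → ZMod m)) (M : GMF 𝕜 ν m L ι₀ ι₁), GMFData.IsRigid 𝕜 L M.toGMFData →
    ∀ (n : ℕ) (Φ : Matrix ι₀ ι₁ (MvPolynomial (Fin ν) (WittVector p 𝕜)))
    (Ψ : Matrix ι₁ ι₀ (MvPolynomial (Fin ν) (WittVector p 𝕜))),
    (∀ i j, IsBihom m L (Φ i j) (M.d₁ j - M.d₀ i) (M.c₁ j - M.c₀ i)) →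
    (∀ j i, IsBihom m L (Ψ j i) (M.d₀ i + m - M.d₁ j) (M.c₀ i - M.c₁ j)) →
    Φ.map (MvPolynomial.map WittVector.constantCoeff) = M.φ →
    Ψ.map (MvPolynomial.map WittVector.constantCoeff) = M.ψ →
    (Φ * Ψ).map (MvPolynomial.map (WittVector.truncate (n + 1))) =
      (fermatForm (WittVector p 𝕜) ν m • (1 : Matrix ι₀ ι₀ (MvPolynomial (Fin ν) (WittVector p 𝕜)))).map
        (MvPolynomial.map (WittVector.truncate (n + 1))) →
    (Ψ * Φ).map (MvPolynomial.map (WittVector.truncate (n + 1))) =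
      (fermatForm (WittVector p 𝕜) ν m • (1 : Matrix ι₁ ι₁ (MvPolynomial (Fin ν) (WittVector p 𝕜)))).map
        (MvPolynomial.map (WittVector.truncate (n + 1))) →
    ∃ (Φ' : Matrix ι₀ ι₁ (MvPolynomial (Fin ν) (WittVector p 𝕜)))
      (Ψ' : Matrix ι₁ ι₀ (MvPolynomial (Fin ν) (WittVector p 𝕜))),
      (∀ i j, IsBihom m L (Φ' i j) (M.d₁ j - M.d₀ i) (M.c₁ j - M.c₀ i)) ∧
      (∀ j i, IsBihom m L (Ψ' j i) (M.d₀ i + m - M.d₁ j) (M.c₀ i - M.c₁ j)) ∧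
      Φ'.map (MvPolynomial.map WittVector.constantCoeff) = M.φ ∧
      Ψ'.map (MvPolynomial.map WittVector.constantCoeff) = M.ψ ∧
      (Φ' * Ψ').map (MvPolynomial.map (WittVector.truncate (n + 2))) =
        (fermatForm (WittVector p 𝕜) ν m • (1 : Matrix ι₀ ι₀ (MvPolynomial (Fin ν) (WittVector p 𝕜)))).map
          (MvPolynomial.map (WittVector.truncate (n + 2))) ∧
      (Ψ' * Φ').map (MvPolynomial.map (WittVector.truncate (n + 2))) =
        (fermatForm (WittVector p 𝕜) ν m • (1 : Matrix ι₁ ι₁ (MvPolynomial (Fin ν) (WittVector p 𝕜)))).map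
          (MvPolynomial.map (WittVector.truncate (n + 2))) ∧
      Φ'.map (MvPolynomial.map (WittVector.truncate (n + 1))) =
        Φ.map (MvPolynomial.map (WittVector.truncate (n + 1))) ∧
      Ψ'.map (MvPolynomial.map (WittVector.truncate (n + 1))) =
        Ψ.map (MvPolynomial.map (WittVector.truncate (n + 1))) := by
  intro p _ 𝕜 _ _ _ ν m ι₀ ι₁ _ _ _ _ L M hM n Φ Ψ hΦ hΨ hΦr hΨr h1 h2
  -- notation-free abbreviations
  set P : WittVector p 𝕜 := (p : WittVector p 𝕜) ^ (n + 1) with hP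
  set f : MvPolynomial (Fin ν) (WittVector p 𝕜) := fermatForm (WittVector p 𝕜) ν m with hf
  -- (1) exact division of the errors by `pⁿ⁺¹`
  obtain ⟨A, hA, hAsupp⟩ := exists_eq_smul_of_dvd_coeff P (Φ * Ψ - f • 1)
    (dvd_coeff_of_map_truncate_eq (n + 1) h1)
  obtain ⟨B, hB, hBsupp⟩ := exists_eq_smul_of_dvd_coeff P (Ψ * Φ - f • 1)
    (dvd_coeff_of_map_truncate_eq (n + 1) h2)
  have hA' : Φ * Ψ = f • 1 + P • A := sub_eq_iff_eq_add'.mp hA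
  have hB' : Ψ * Φ = f • 1 + P • B := sub_eq_iff_eq_add'.mp hB
  -- (2) the errors are bihomogeneous (even cochains of twist `m`)
  have hfb : IsBihom m L f (m : ℤ) 0 := isBihom_fermatForm _ L
  have hAb : ∀ i i', IsBihom m L (A i i') (M.d₀ i' - M.d₀ i + m) (M.c₀ i' - M.c₀ i) := by
    intro i i'
    refine IsBihom.of_support_subset
      (q := (Φ * Ψ - f • 1 : Matrix ι₀ ι₀ (MvPolynomial (Fin ν) (WittVector p 𝕜))) i i') ?_ (hAsupp i i')
    rw [Matrix.sub_apply]
    refine IsBihom.sub ?_ (isBihom_smul_one_apply hfb M.d₀ M.c₀ i i')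
    exact isBihom_congr (isBihom_mul_apply (dκ := M.d₀) (cκ := M.c₀) (dι := M.d₁) (cι := M.c₁)
      (dο := M.d₀) (cο := M.c₀) (t := 0) (t' := (m : ℤ)) (X := Φ) (Y := Ψ)
      (fun i j ↦ isBihom_congr (hΦ i j) (by ring) rfl) (fun j i' ↦ isBihom_congr (hΨ j i') (by ring) rfl)
      i i') (by ring) rfl
  have hBb : ∀ j j', IsBihom m L (B j j') (M.d₁ j' - M.d₁ j + m) (M.c₁ j' - M.c₁ j) := by
    intro j j'
    refine IsBihom.of_support_subset
      (q := (Ψ * Φ - f • 1 : Matrix ι₁ ι₁ (MvPolynomial (Fin ν) (WittVector p 𝕜))) j j') ?_ (hBsupp j j')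
    rw [Matrix.sub_apply]
    refine IsBihom.sub ?_ (isBihom_smul_one_apply hfb M.d₁ M.c₁ j j')
    exact isBihom_congr (isBihom_mul_apply (dκ := M.d₁) (cκ := M.c₁) (dι := M.d₀) (cι := M.c₀)
      (dο := M.d₁) (cο := M.c₁) (t := (m : ℤ)) (t' := 0) (X := Ψ) (Y := Φ)
      (fun j i ↦ isBihom_congr (hΨ j i) (by ring) rfl) (fun i j' ↦ isBihom_congr (hΦ i j') (by ring) rfl)
      j j') (by ring) rfl
  -- (3) the error pair is CLOSED: `AΦ = ΦB`, `ΨA = BΨ` (torsion-freeness of `𝕎 𝕜`)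
  have hAΦ : A * Φ = Φ * B := by
    apply p_pow_smul_cancel (n + 1)
    have e := Matrix.mul_assoc Φ Ψ Φ
    rw [hA', hB', Matrix.add_mul, Matrix.mul_add, Matrix.smul_mul, Matrix.smul_mul, Matrix.mul_smul,
      Matrix.mul_smul, Matrix.one_mul, Matrix.mul_one] at e
    exact add_left_cancel e
  have hΨA : Ψ * A = B * Ψ := by
    apply p_pow_smul_cancel (n + 1)
    have e := Matrix.mul_assoc Ψ Φ Ψ
    rw [hA', hB', Matrix.add_mul, Matrix.mul_add, Matrix.smul_mul, Matrix.smul_mul, Matrix.mul_smul,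
      Matrix.mul_smul, Matrix.one_mul, Matrix.mul_one] at e
    exact (add_left_cancel e).symm
  -- (4) reduce mod `p`: a closed even cochain of twist `m` of `M`
  have hclosed : (A.map (MvPolynomial.map WittVector.constantCoeff),
      B.map (MvPolynomial.map WittVector.constantCoeff)) ∈
        GMFData.closedSet m L (m : ℤ) M.toGMFData M.toGMFData := by
    refine ⟨⟨fun i i' ↦ ?_, fun j j' ↦ ?_⟩, ?_, ?_⟩
    · exact (hAb i i').map _
    · exact (hBb j j').map _
    · change A.map (MvPolynomial.map WittVector.constantCoeff) * M.φ =
        M.φ * B.map (MvPolynomial.map WittVector.constantCoeff)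
      rw [← hΦr, ← Matrix.map_mul, hAΦ, Matrix.map_mul]
    · change M.ψ * A.map (MvPolynomial.map WittVector.constantCoeff) =
        B.map (MvPolynomial.map WittVector.constantCoeff) * M.ψ
      rw [← hΨr, ← Matrix.map_mul, hΨA, Matrix.map_mul]
  -- (5) rigidity: it is null-homotopic
  obtain ⟨s, u, hs, hu, hsu1, hsu2⟩ :=
    closedSet_subset_nullSet_of_isRigid 𝕜 ν m ι₀ ι₁ L M.toGMFData hM hclosed
  -- (6) Teichmüller lifts of the homotopy
  obtain ⟨S, hS, hSsupp⟩ := exists_lift_matrix p 𝕜 s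
  obtain ⟨U, hU, hUsupp⟩ := exists_lift_matrix p 𝕜 u
  have hSb : ∀ l i, IsBihom m L (S l i) (M.d₀ i + m - M.d₁ l) (M.c₀ i - M.c₁ l) :=
    fun l i ↦ isBihom_congr ((hs l i).of_support_subset (hSsupp l i)) (by ring) rfl
  have hUb : ∀ k j, IsBihom m L (U k j) (M.d₁ j - M.d₀ k) (M.c₁ j - M.c₀ k) :=
    fun k j ↦ isBihom_congr ((hu k j).of_support_subset (hUsupp k j)) (by ring) rfl
  -- (7) the corrections `A − (UΨ + ΦS)`, `B − (SΦ + ΨU)` vanish mod `p`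
  obtain ⟨C, hC, -⟩ := exists_eq_smul_of_dvd_coeff (p : WittVector p 𝕜) (A - (U * Ψ + Φ * S))
    (dvd_coeff_of_map_constantCoeff_eq (by
      rw [Matrix.map_add _ (map_add _), Matrix.map_mul, Matrix.map_mul, hU, hS, hΦr, hΨr]
      exact hsu1))
  obtain ⟨D, hD, -⟩ := exists_eq_smul_of_dvd_coeff (p : WittVector p 𝕜) (B - (S * Φ + Ψ * U))
    (dvd_coeff_of_map_constantCoeff_eq (by
      rw [Matrix.map_add _ (map_add _), Matrix.map_mul, Matrix.map_mul, hU, hS, hΦr, hΨr]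
      exact hsu2))
  have hC' : A = U * Ψ + Φ * S + (p : WittVector p 𝕜) • C := sub_eq_iff_eq_add'.mp hC
  have hD' : B = S * Φ + Ψ * U + (p : WittVector p 𝕜) • D := sub_eq_iff_eq_add'.mp hD
  -- (8) the corrected pair
  have hPp : P * (p : WittVector p 𝕜) = (p : WittVector p 𝕜) ^ (n + 2) := by rw [hP, ← pow_succ]
  have hPP : P * P = (p : WittVector p 𝕜) ^ (2 * n + 2) := by rw [hP, ← pow_add]; ring_nf
  have key₁ : (Φ - P • U) * (Ψ - P • S) =
      f • 1 + (p : WittVector p 𝕜) ^ (n + 2) • C + (p : WittVector p 𝕜) ^ (2 * n + 2) • (U * S) := by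
    rw [Matrix.sub_mul, Matrix.mul_sub, Matrix.mul_sub, Matrix.smul_mul, Matrix.smul_mul,
      Matrix.mul_smul, Matrix.mul_smul, smul_smul, hA', hC', ← hPp, ← hPP, smul_add, smul_add,
      smul_smul]
    abel
  have key₂ : (Ψ - P • S) * (Φ - P • U) =
      f • 1 + (p : WittVector p 𝕜) ^ (n + 2) • D + (p : WittVector p 𝕜) ^ (2 * n + 2) • (S * U) := by
    rw [Matrix.sub_mul, Matrix.mul_sub, Matrix.mul_sub, Matrix.smul_mul, Matrix.smul_mul,
      Matrix.mul_smul, Matrix.mul_smul, smul_smul, hB', hD', ← hPp, ← hPP, smul_add, smul_add,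
      smul_smul]
    abel
  refine ⟨Φ - P • U, Ψ - P • S, fun i j ↦ (hΦ i j).sub ((hUb i j).smul P),
    fun j i ↦ (hΨ j i).sub ((hSb j i).smul P), ?_, ?_, ?_, ?_, ?_, ?_⟩
  · rw [map_constantCoeff_sub_p_pow_smul (Nat.succ_ne_zero n), hΦr]
  · rw [map_constantCoeff_sub_p_pow_smul (Nat.succ_ne_zero n), hΨr]
  · rw [key₁, map_truncate_add_add le_rfl (by omega)]
  · rw [key₂, map_truncate_add_add le_rfl (by omega)]
  · exact map_truncate_sub_p_pow_smul le_rfl Φ U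
  · exact map_truncate_sub_p_pow_smul le_rfl Ψ S

end Summit.HodgeConjecture.HodgeConjecture.Cruxes.FermatAnchorAssembly.WittLiftRigidMf

end
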